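import Literature.Topology.FourManifolds.KhTriangleLocal
import HarnessLib

/-!
# The third Reidemeister move: computable local reachability and the sector transfers

Sibling file of `KhComplex.lean`, continuing `KhTriangleLocal.lean`: a Boolean reachability
test `locReachB` on the abstract local graphs of the triangle (breadth-first closure, sound:
`reachable_of_locReachB`), the **attaching map** `attach E` sending each abstract side to an end
of its local component, and the four **sector transfer** theorems `reach_G_G'`, `reach_G'_G`,
`reach_G_G`, `reach_G'_G'`: reachability in a state graph of `G` (resp. `G.braidMove x y z`)
over a state with prescribed smoothings of `x, y, z` implies reachability of the retouched arcs
in a state graph of the other (or the same) side over a state with other prescribed smoothings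
of `x, y, z` and the same smoothings elsewhere — provided a finite Boolean check, discharged by
`decide` at each use. Khovanov (2000), §5.4; Bar-Natan (2002), §4.4. No named fact is introduced.

## References

* M. Khovanov, *A categorification of the Jones polynomial*, Duke Math. J. 101 (2000) 359–426,
  §5.4. [cite: Khovanov2000, §5.4]
* D. Bar-Natan, *On Khovanov's categorification of the Jones polynomial*, Algebr. Geom. Topol. 2
  (2002) 337–370, §4.4. [cite: BarNatan2002, §4]
-/

open Function

namespace Literature.Topology.FourManifolds

namespace GaussDiagram

open LocArc

/-! ## Boolean reachability in the abstract local graphs -/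

/-- One step of breadth-first closure in the local graph of `E`. [folklore] -/
def locStep (E : List (LocArc × LocArc)) (S : LocArc → Bool) (b : LocArc) : Bool :=
  S b || E.any fun e ↦ (S e.1 && e.2 == b) || (S e.2 && e.1 == b)

/-- **Boolean reachability** in the local graph of `E` (nine closure steps suffice on nine
vertices; only soundness is used). [folklore] -/
def locReachB (E : List (LocArc × LocArc)) (a b : LocArc) : Bool :=
  (locStep E)^[9] (fun c ↦ c == a) b

/-- Soundness of one closure step. [folklore] -/
theorem reachable_of_locStep (E : List (LocArc × LocArc)) (a : LocArc) {S : LocArc → Bool}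
    (hS : ∀ c, S c = true → (locGraph E).Reachable a c) (b : LocArc) (hb : locStep E S b = true) :
    (locGraph E).Reachable a b := by
  unfold locStep at hb
  simp only [Bool.or_eq_true, List.any_eq_true, Bool.and_eq_true, beq_iff_eq] at hb
  rcases hb with hb | ⟨e, he, ⟨h1, rfl⟩ | ⟨h1, rfl⟩⟩
  · exact hS b hb
  · exact (hS _ h1).trans (locGraph_reachable_of_mem he)
  · exact (hS _ h1).trans (locGraph_reachable_of_mem he).symm

/-- **Soundness of Boolean reachability.** [folklore] -/
theorem reachable_of_locReachB {E : List (LocArc × LocArc)} {a b : LocArc} (h : locReachB E a b = true) :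
    (locGraph E).Reachable a b := by
  unfold locReachB at h
  suffices key : ∀ (n : ℕ) (S : LocArc → Bool), (∀ c, S c = true → (locGraph E).Reachable a c) →
      ∀ c, (locStep E)^[n] S c = true → (locGraph E).Reachable a c from
    key 9 _ (fun c hc ↦ by rw [beq_iff_eq] at hc; rw [hc]) b h
  intro n
  induction n with
  | zero => intro S hS c hc; exact hS c hc
  | succ n ih =>
    intro S hS c hc
    rw [Function.iterate_succ_apply'] at hc
    exact reachable_of_locStep E a (ih S hS) c hc

/-- The six abstract ends, in a fixed order. [folklore] -/
def locEnds : List LocArc := [.inA, .outA, .inB, .outB, .inC, .outC]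

/-- **The attaching map** of a local graph: each abstract side goes to the first end in its
local component (itself if there is none), the ends stay. [folklore] -/
def attach (E : List (LocArc × LocArc)) (a : LocArc) : LocArc :=
  if a.IsSide then ((locEnds.filter fun e ↦ locReachB E a e).head?).getD a else a

/-- The attaching map fixes the ends. [folklore] -/
theorem attach_of_not_isSide (E : List (LocArc × LocArc)) {a : LocArc} (ha : ¬ a.IsSide) : attach E a = a := by
  unfold attach; rw [if_neg ha]

section Transfer

variable (G : GaussDiagram) {x y z : Fin G.n}
variable (hxz : x ≠ z) (ha : (G.overPos y : ℕ) = G.overPos x + 1) (hb : (G.overPos z : ℕ) = G.underPos x + 1)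
  (hc : (G.underPos z : ℕ) = G.underPos y + 1) (hx : G.sign x = 1) (hy : G.sign y = 1) (hz : G.sign z = 1)

/-- The decidable hypothesis of a sector transfer: every local pair of the source becomes
Boolean-reachable in the target after attaching. [folklore] -/
def LocCheck (E₁ E₂ : List (LocArc × LocArc)) : Prop :=
  ∀ e ∈ E₁, locReachB E₂ (attach E₁ e.1) (attach E₁ e.2) = true

/-- The local check is decidable. [folklore] -/
instance (E₁ E₂ : List (LocArc × LocArc)) : Decidable (LocCheck E₁ E₂) := by
  unfold LocCheck; infer_instance

/-- The local check gives the hypothesis `hloc` of the transfer principle. [folklore] -/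
theorem hloc_of_locCheck {E₁ E₂ : List (LocArc × LocArc)} (h : LocCheck E₁ E₂) :
    ∀ e ∈ E₁, (locGraph E₂).Reachable (attach E₁ e.1) (attach E₁ e.2) := fun e he ↦
  reachable_of_locReachB (h e he)

include hxz ha hb hc hx hy hz in
/-- **Sector transfer from `G` to the braid rearrangement.** [cite: Khovanov2000, §5.4] -/
theorem reach_G_G' {bx by_ bz bx' by' bz' : Bool} (hchk : LocCheck (locEdgesG bx by_ bz) (locEdgesG' bx' by' bz'))
    {τ τ' : G.State} (hτ : ∀ j, j ≠ x → j ≠ y → j ≠ z → τ j = τ' j)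
    (h1 : τ x = bx) (h2 : τ y = by_) (h3 : τ z = bz) (h1' : τ' x = bx') (h2' : τ' y = by') (h3' : τ' z = bz')
    {u v : G.Arc} (h : (G.stateGraph τ).Reachable u v) :
    ((G.braidMove x y z).stateGraph τ').Reachable (G.retouch x y z (attach (locEdgesG bx by_ bz)) u)
      (G.retouch x y z (attach (locEdgesG bx by_ bz)) v) := by
  subst h1 h2 h3 h1' h2' h3'
  exact G.reachable_transfer hxz ha hb hc _ (fun a ha' ↦ attach_of_not_isSide _ ha') (hloc_of_locCheck hchk)
    (G.adj_cases_G ha hb hc hx hy hz τ (G.hnl_G' hτ))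
    (fun e he ↦ G.reachable_braidMove_locArc_of_mem hxz ha hb hc hx hy hz τ' he) h

include hxz ha hb hc hx hy hz in
/-- **Sector transfer from the braid rearrangement to `G`.** [cite: Khovanov2000, §5.4] -/
theorem reach_G'_G {bx by_ bz bx' by' bz' : Bool} (hchk : LocCheck (locEdgesG' bx by_ bz) (locEdgesG bx' by' bz'))
    {τ τ' : G.State} (hτ : ∀ j, j ≠ x → j ≠ y → j ≠ z → τ j = τ' j)
    (h1 : τ x = bx) (h2 : τ y = by_) (h3 : τ z = bz) (h1' : τ' x = bx') (h2' : τ' y = by') (h3' : τ' z = bz')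
    {u v : G.Arc} (h : ((G.braidMove x y z).stateGraph τ).Reachable u v) :
    (G.stateGraph τ').Reachable (G.retouch x y z (attach (locEdgesG' bx by_ bz)) u)
      (G.retouch x y z (attach (locEdgesG' bx by_ bz)) v) := by
  subst h1 h2 h3 h1' h2' h3'
  exact G.reachable_transfer hxz ha hb hc _ (fun a ha' ↦ attach_of_not_isSide _ ha') (hloc_of_locCheck hchk)
    (G.adj_cases_G' hxz ha hb hc hx hy hz τ (G.hnl_G hτ))
    (fun e he ↦ G.reachable_locArc_of_mem ha hb hc hx hy hz τ' he) h

include hxz ha hb hc hx hy hz in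
/-- **Sector transfer within `G`.** [folklore] -/
theorem reach_G_G {bx by_ bz bx' by' bz' : Bool} (hchk : LocCheck (locEdgesG bx by_ bz) (locEdgesG bx' by' bz'))
    {τ τ' : G.State} (hτ : ∀ j, j ≠ x → j ≠ y → j ≠ z → τ j = τ' j)
    (h1 : τ x = bx) (h2 : τ y = by_) (h3 : τ z = bz) (h1' : τ' x = bx') (h2' : τ' y = by') (h3' : τ' z = bz')
    {u v : G.Arc} (h : (G.stateGraph τ).Reachable u v) :
    (G.stateGraph τ').Reachable (G.retouch x y z (attach (locEdgesG bx by_ bz)) u)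
      (G.retouch x y z (attach (locEdgesG bx by_ bz)) v) := by
  subst h1 h2 h3 h1' h2' h3'
  exact G.reachable_transfer hxz ha hb hc _ (fun a ha' ↦ attach_of_not_isSide _ ha') (hloc_of_locCheck hchk)
    (G.adj_cases_G ha hb hc hx hy hz τ (G.hnl_G hτ))
    (fun e he ↦ G.reachable_locArc_of_mem ha hb hc hx hy hz τ' he) h

include hxz ha hb hc hx hy hz in
/-- **Sector transfer within the braid rearrangement.** [folklore] -/
theorem reach_G'_G' {bx by_ bz bx' by' bz' : Bool} (hchk : LocCheck (locEdgesG' bx by_ bz) (locEdgesG' bx' by' bz'))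
    {τ τ' : G.State} (hτ : ∀ j, j ≠ x → j ≠ y → j ≠ z → τ j = τ' j)
    (h1 : τ x = bx) (h2 : τ y = by_) (h3 : τ z = bz) (h1' : τ' x = bx') (h2' : τ' y = by') (h3' : τ' z = bz')
    {u v : G.Arc} (h : ((G.braidMove x y z).stateGraph τ).Reachable u v) :
    ((G.braidMove x y z).stateGraph τ').Reachable (G.retouch x y z (attach (locEdgesG' bx by_ bz)) u)
      (G.retouch x y z (attach (locEdgesG' bx by_ bz)) v) := by
  subst h1 h2 h3 h1' h2' h3'
  exact G.reachable_transfer hxz ha hb hc _ (fun a ha' ↦ attach_of_not_isSide _ ha') (hloc_of_locCheck hchk)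
    (G.adj_cases_G' hxz ha hb hc hx hy hz τ (G.hnl_G' hτ))
    (fun e he ↦ G.reachable_braidMove_locArc_of_mem hxz ha hb hc hx hy hz τ' he) h

end Transfer

/-! ## The finite checks for the sectors used downstream -/

set_option maxRecDepth 8192 in
/-- Layer `z = 0`, from `G` at `(bx, by, 0)` to the rearrangement at `(by, bx, 0)`. [folklore] -/
theorem locCheck_Z0_G_G' (bx by_ : Bool) : LocCheck (locEdgesG bx by_ false) (locEdgesG' by_ bx false) := by
  cases bx <;> cases by_ <;> decide

set_option maxRecDepth 8192 in
/-- Layer `z = 0`, from the rearrangement at `(by, bx, 0)` back to `G` at `(bx, by, 0)`. [folklore] -/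
theorem locCheck_Z0_G'_G (bx by_ : Bool) : LocCheck (locEdgesG' by_ bx false) (locEdgesG bx by_ false) := by
  cases bx <;> cases by_ <;> decide

set_option maxRecDepth 8192 in
/-- The sector `D = (0, 1, 1)`, both directions. [folklore] -/
theorem locCheck_D : LocCheck (locEdgesG false true true) (locEdgesG' false true true) ∧
    LocCheck (locEdgesG' false true true) (locEdgesG false true true) := by decide

set_option maxRecDepth 8192 in
/-- From `G` at `(0, 1, 0)` to the rearrangement at `(0, 0, 1)` and back. [folklore] -/
theorem locCheck_010_001 : LocCheck (locEdgesG false true false) (locEdgesG' false false true) ∧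
    LocCheck (locEdgesG' false false true) (locEdgesG false true false) := by decide

set_option maxRecDepth 8192 in
/-- Within `G`, between `(1, 0, 0)` and `(0, 0, 1)`. [folklore] -/
theorem locCheck_G_100_001 : LocCheck (locEdgesG true false false) (locEdgesG false false true) ∧
    LocCheck (locEdgesG false false true) (locEdgesG true false false) := by decide

set_option maxRecDepth 8192 in
/-- Within the rearrangement, between `(1, 0, 0)` and `(0, 0, 1)`. [folklore] -/
theorem locCheck_G'_100_001 : LocCheck (locEdgesG' true false false) (locEdgesG' false false true) ∧
    LocCheck (locEdgesG' false false true) (locEdgesG' true false false) := by decide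

end GaussDiagram

end Literature.Topology.FourManifolds
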